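import Summits.SmoothPoincare4.SmoothPoincare4.Theorems.WeakReductionDescentDependentTripleGenusThreeStandardStubBoundsDiscOfAnnularChartAux1
import Summits.SmoothPoincare4.SmoothPoincare4.Theorems.WeakReductionDescentDependentTripleGenusThreeStandardStubBoundsDiscOfAnnularChartAux2
import Literature.Topology.FourManifolds.WeaklyReducibleTrisections
import Literature.Topology.FourManifolds.CollarReparamCalculus
import HarnessLib

/-!
# Crux `WeakReductionDescent.DependentTripleGenusThreeStandard` (stmt-SmoothPoincare4-18000), line
# `Sketch`: stub 3a `stub_boundsDisc_of_annularChart` — compressing discs transport across an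
# annular chart of the central surface

Stub file (`--supports stmt-SmoothPoincare4-18000`) of the registered skeleton
`Cruxes/DependentTripleGenusThreeStandard/Lines/Sketch.lean` (v5), proving VERBATIM its stub
`stub_boundsDisc_of_annularChart` (Aranda–Zupan 2025, §7 configuration (1), "two of the curves
are homotopic", arXiv:2503.04607 p. 24; Remark 2.1 p. 3): for ANY Gay–Kirby trisection `T` of a
smooth `4`-manifold `M`, a handlebody of the spine `H_p = spineHandlebody T p` and two curves
`a`, `b` of the central surface `F = centralSurfaceSet T` which are the round circles of radii
`r₀`, `r₁` of a plane map `ψ` smooth, injective and immersive INTO `M` on an open round annulus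
with image in `F`, if `a` bounds a properly embedded disc in `H_p` then so does `b`.

Proof (everything proved in the tree; the two new tools are the registered helpers of the Aux
files):

* clause (iii) of `IsGKTrisection` for the pair `(p + 1, p + 2)`: a compact `3`-manifold with
  boundary `H` and a smooth embedding `h : H → M` with `range h = H_p`
  (`Trisection.spineHandlebody_eq_inter`) and `h(∂H) = F`;
* `helper_exists_diffeomorph_sweep_of_annularChart` (Aux2: transfer of the chart to the closed
  surface `∂H`, `SurfaceCircleSweep.exists_ambientIsotopy_sweep_circle_of_annulus`,
  `AmbientIsotopy.isDiffeotopicToId`, `BoundaryData.diffeoExtends_of_isDiffeotopicToId_holds`):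
  a diffeomorphism `Φ` of `H` with `Φ(∂H) = ∂H` and `Φ (h⁻¹ (ψ (r₀ x))) = h⁻¹ (ψ (r₁ x))`;
* the new disc is `d′ = h ∘ Φ ∘ h⁻¹ ∘ d`: smooth (`h⁻¹` is smooth on `range h ⊇ range d`,
  `Literature.Geometry.Manifold.contMDiffOn_invFun_range`), injective, with injective
  differential (chain rule; `injective_mfderiv_of_isSmoothEmbedding` for `d`, `Φ`, `h`), hence a
  smooth embedding of the closed disc by the intrinsic criterion
  `helper_isSmoothEmbedding_closedBall_of_injective_mfderiv` (Aux1: bump + Seeley extension +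
  the ambient criterion of `ClosedBallSmoothEmbeddings.lean`); its image lies in `h(H) = H_p`,
  its boundary circle is `h(Φ(h⁻¹ a)) = b`, and it meets `F = h(∂H)` exactly in `b` because `Φ`
  preserves `∂H` and `h` is injective.

No definitions, no named facts.

References: R. Aranda, A. Zupan, arXiv:2503.04607 (2025), §7 (p. 24) configuration (1),
Remark 2.1 (p. 3); M. W. Hirsch, *Differential Topology* (1976), Ch. 8 §1 Thm. 1.3, §2
Thm. 2.3; D. Gay, R. Kirby, Geom. Topol. 20 (2016), Def. 1.
-/

-- the registered namespace `Summit.SmoothPoincare4.SmoothPoincare4.Theorems…` repeats a component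
set_option linter.dupNamespace false

noncomputable section

open scoped Manifold ContDiff Topology ContinuousMap
open Set Function
open Literature.Topology.FourManifolds
open Literature.Topology.FourManifolds.Trisection

namespace Summit.SmoothPoincare4.SmoothPoincare4.Theorems

/-- **Stub 3a of the skeleton `Lines/Sketch.lean` of the crux `DependentTripleGenusThreeStandard`:
compressing discs transport across an annular chart of the central surface** (Aranda–Zupan
2025, §7 configuration (1)).  See the module docstring for the statement and the proof.
[cite: ArandaZupan2025, §7 (p. 24), configuration (1); Remark 2.1 (p. 3)]
[cite: HirschDT1976, Ch. 8 §1 Thm. 1.3 and Ch. 8 §2 proof of Thm. 2.3] -/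
theorem stub_boundsDisc_of_annularChart :
    ∀ (M : Type) [TopologicalSpace M] [T2Space M] [SecondCountableTopology M]
      [ChartedSpace (EuclideanSpace ℝ (Fin 4)) M] [IsManifold (𝓡 4) ∞ M],
      ∀ (g : ℕ) (k : Fin 3 → ℕ) (T : Fin 3 → Set M), IsGKTrisection M g k T →
      ∀ (p : Fin 3) (a b : Set M), IsCurve T a → IsCurve T b →
      (∃ (ψ : EuclideanSpace ℝ (Fin 2) → M) (rlo r₀ r₁ rhi : ℝ),
        0 < r₀ ∧ 0 < r₁ ∧ rlo < r₀ ∧ rlo < r₁ ∧ r₀ < rhi ∧ r₁ < rhi ∧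
        ContMDiffOn (𝓡 2) (𝓡 4) ∞ ψ {x | rlo < ‖x‖ ∧ ‖x‖ < rhi} ∧
        Set.InjOn ψ {x | rlo < ‖x‖ ∧ ‖x‖ < rhi} ∧
        (∀ x : EuclideanSpace ℝ (Fin 2), rlo < ‖x‖ → ‖x‖ < rhi →
          Function.Injective (mfderiv (𝓡 2) (𝓡 4) ψ x)) ∧
        ψ '' {x | rlo < ‖x‖ ∧ ‖x‖ < rhi} ⊆ centralSurfaceSet T ∧
        (Set.range fun x : Metric.sphere (0 : EuclideanSpace ℝ (Fin 2)) 1 =>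
          ψ (r₀ • (x : EuclideanSpace ℝ (Fin 2)))) = a ∧
        (Set.range fun x : Metric.sphere (0 : EuclideanSpace ℝ (Fin 2)) 1 =>
          ψ (r₁ • (x : EuclideanSpace ℝ (Fin 2)))) = b) →
      BoundsDisc T (spineHandlebody T p) a → BoundsDisc T (spineHandlebody T p) b := by
  intro M _ _ _ _ _ g k T hT p a b ha hb hψ hda
  obtain ⟨ψ, rlo, r₀, r₁, rhi, h₀, h₁, hlo₀, hlo₁, hhi₀, hhi₁, hs, hinj, himm, hψF, hra, hrb⟩ := hψ
  obtain ⟨d, hd, hdA, hdb, hdF⟩ := hda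
  -- clause (iii): the handlebody `H_p = h(H)` with `h(∂H) = F`
  have hne : (p + 1 : Fin 3) ≠ p + 2 := by
    have key : ∀ q : Fin 3, q + 1 ≠ q + 2 := by decide
    exact key p
  obtain ⟨H, _, _, h, hM, hHc, -, -, hh, hrange, hbd⟩ := hT.2.2 (p + 1) (p + 2) hne
  haveI := hM
  haveI := hHc
  have hHp : spineHandlebody T p = range h := by rw [spineHandlebody_eq_inter, hrange]
  have hF : centralSurfaceSet T = h '' (𝓡∂ 3).boundary H := hbd.symm
  have hbF : b ⊆ centralSurfaceSet T := hb.1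
  have hFH : centralSurfaceSet T ⊆ range h := by
    rw [← hHp]; exact centralSurfaceSet_subset_spineHandlebody T p
  have hdH : ∀ y, d y ∈ range h := fun y => by rw [← hHp]; exact hdA (mem_range_self y)
  -- `H` is nonempty: the curve `a` is a nonempty subset of `F ⊆ h(H)`
  set x₀ : Metric.sphere (0 : EuclideanSpace ℝ (Fin 2)) 1 :=
    ⟨EuclideanSpace.single 0 1, by simp⟩ with hx₀_def
  haveI : Nonempty H := by
    have hmem : ψ (r₀ • (x₀ : EuclideanSpace ℝ (Fin 2))) ∈ a := by
      rw [← hra]; exact mem_range_self x₀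
    obtain ⟨z, -⟩ := hFH (ha.1 hmem)
    exact ⟨z⟩
  -- the sweeping diffeomorphism of `H`
  have hψbd : ψ '' {x | rlo < ‖x‖ ∧ ‖x‖ < rhi} ⊆ h '' (𝓡∂ 3).boundary H := by
    rw [← hF]; exact hψF
  obtain ⟨Φ, hΦbd, hΦψ⟩ :=
    helper_exists_diffeomorph_sweep_of_annularChart M H h hh ψ rlo r₀ r₁ rhi h₀ h₁ hlo₀ hlo₁
      hhi₀ hhi₁ hs hinj himm hψbd
  -- the new disc `d' = h ∘ Φ ∘ h⁻¹ ∘ d`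
  set e₀ : Metric.closedBall (0 : EuclideanSpace ℝ (Fin 2)) 1 → H := fun y => invFun h (d y)
    with he₀_def
  set d' : Metric.closedBall (0 : EuclideanSpace ℝ (Fin 2)) 1 → M := fun y => h (Φ (e₀ y))
    with hd'_def
  have hde₀ : ∀ y, h (e₀ y) = d y := fun y => invFun_eq (hdH y)
  -- smoothness
  have hinvh : ContMDiffOn (𝓡 4) (𝓡∂ 3) ∞ (invFun h) (range h) :=
    Literature.Geometry.Manifold.contMDiffOn_invFun_range hh
  have he₀s : ContMDiff (𝓡∂ 2) (𝓡∂ 3) ∞ e₀ := hinvh.comp_contMDiff hd.contMDiff hdH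
  have hΦe₀s : ContMDiff (𝓡∂ 2) (𝓡∂ 3) ∞ (fun y => Φ (e₀ y)) := Φ.contMDiff.comp he₀s
  have hd's : ContMDiff (𝓡∂ 2) (𝓡 4) ∞ d' := hh.contMDiff.comp hΦe₀s
  -- injectivity
  have he₀inj : Injective e₀ := fun y y' hyy =>
    hd.isEmbedding.injective (by rw [← hde₀ y, ← hde₀ y']; exact congrArg h hyy)
  have hd'inj : Injective d' := fun y y' hyy =>
    he₀inj (Φ.injective (hh.isEmbedding.injective hyy))
  -- injective differential
  have hΦemb : Manifold.IsSmoothEmbedding (𝓡∂ 3) (𝓡∂ 3) ∞ (⇑Φ) :=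
    Manifold.IsSmoothEmbedding.id.diffeomorph_comp Φ
  have hd'imm : ∀ y, Injective (mfderiv (𝓡∂ 2) (𝓡 4) d' y) := by
    intro y
    have h1 : MDifferentiableAt (𝓡∂ 2) (𝓡∂ 3) e₀ y := (he₀s y).mdifferentiableAt (by simp)
    have h2 : MDifferentiableAt (𝓡∂ 3) (𝓡∂ 3) Φ (e₀ y) := (Φ.contMDiff _).mdifferentiableAt (by simp)
    have h3 : MDifferentiableAt (𝓡∂ 3) (𝓡 4) h (Φ (e₀ y)) := (hh.contMDiff _).mdifferentiableAt (by simp)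
    have h3' : MDifferentiableAt (𝓡∂ 3) (𝓡 4) h (e₀ y) := (hh.contMDiff _).mdifferentiableAt (by simp)
    have h21 : MDifferentiableAt (𝓡∂ 2) (𝓡∂ 3) (⇑Φ ∘ e₀) y := h2.comp y h1
    -- `d e₀` is injective since `d = h ∘ e₀` has injective differential
    have hde : d = h ∘ e₀ := funext fun z => (hde₀ z).symm
    have hinj_e₀ : Injective (mfderiv (𝓡∂ 2) (𝓡∂ 3) e₀ y) := by
      have key := injective_mfderiv_of_isSmoothEmbedding hd (by simp) y
      rw [hde, mfderiv_comp y h3' h1] at key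
      intro v w hvw
      apply key
      exact congrArg (mfderiv (𝓡∂ 3) (𝓡 4) h (e₀ y)) hvw
    have hinj_Φ : Injective (mfderiv (𝓡∂ 3) (𝓡∂ 3) Φ (e₀ y)) :=
      injective_mfderiv_of_isSmoothEmbedding hΦemb (by simp) _
    have hinj_h : Injective (mfderiv (𝓡∂ 3) (𝓡 4) h (Φ (e₀ y))) :=
      injective_mfderiv_of_isSmoothEmbedding hh (by simp) _
    have hcomp : mfderiv (𝓡∂ 2) (𝓡 4) d' y =
        (mfderiv (𝓡∂ 3) (𝓡 4) h (Φ (e₀ y))).comp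
          ((mfderiv (𝓡∂ 3) (𝓡∂ 3) Φ (e₀ y)).comp (mfderiv (𝓡∂ 2) (𝓡∂ 3) e₀ y)) := by
      rw [show d' = h ∘ (⇑Φ ∘ e₀) from rfl, mfderiv_comp y h3 h21, mfderiv_comp y h2 h1]
      rfl
    rw [hcomp]
    intro v w hvw
    simp only [ContinuousLinearMap.coe_comp, comp_apply] at hvw
    exact hinj_e₀ (hinj_Φ (hinj_h hvw))
  have hd'emb : Manifold.IsSmoothEmbedding (𝓡∂ 2) (𝓡 4) ∞ d' :=
    helper_isSmoothEmbedding_closedBall_of_injective_mfderiv 4 1 M d' hd's hd'inj hd'imm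
  -- the transport formula on the boundary circle
  have hstep : ∀ (y : Metric.closedBall (0 : EuclideanSpace ℝ (Fin 2)) 1)
      (x : Metric.sphere (0 : EuclideanSpace ℝ (Fin 2)) 1),
      d y = ψ (r₀ • (x : EuclideanSpace ℝ (Fin 2))) →
        d' y = ψ (r₁ • (x : EuclideanSpace ℝ (Fin 2))) := by
    intro y x hyx
    have hb₁ : ψ (r₁ • (x : EuclideanSpace ℝ (Fin 2))) ∈ range h := by
      refine hFH (hbF ?_)
      rw [← hrb]; exact mem_range_self x
    show h (Φ (invFun h (d y))) = _
    rw [hyx, hΦψ x]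
    exact invFun_eq hb₁
  have hbd' : d' '' (𝓡∂ 2).boundary (Metric.closedBall (0 : EuclideanSpace ℝ (Fin 2)) 1) = b := by
    apply Subset.antisymm
    · rintro _ ⟨y, hy, rfl⟩
      have hya : d y ∈ a := by rw [← hdb]; exact mem_image_of_mem d hy
      rw [← hra] at hya
      obtain ⟨x, hx⟩ := hya
      rw [hstep y x hx.symm, ← hrb]
      exact mem_range_self x
    · intro z hz
      rw [← hrb] at hz
      obtain ⟨x, rfl⟩ := hz
      have hxa : ψ (r₀ • (x : EuclideanSpace ℝ (Fin 2))) ∈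
          d '' (𝓡∂ 2).boundary (Metric.closedBall (0 : EuclideanSpace ℝ (Fin 2)) 1) := by
        rw [hdb, ← hra]; exact mem_range_self x
      obtain ⟨y, hy, hyx⟩ := hxa
      exact ⟨y, hy, hstep y x hyx⟩
  refine ⟨d', hd'emb, ?_, hbd', ?_⟩
  · -- `range d' ⊆ H_p = h(H)`
    rw [hHp]
    rintro _ ⟨y, rfl⟩
    exact mem_range_self _
  · -- `range d' ∩ F = b`
    apply Subset.antisymm
    · rintro z ⟨⟨y, rfl⟩, hzF⟩
      -- `Φ (e₀ y) ∈ ∂H`, hence `e₀ y ∈ ∂H`, hence `d y ∈ F`, hence `d y ∈ a`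
      rw [hF] at hzF
      obtain ⟨w, hw, hwy⟩ := hzF
      have hw' : w = Φ (e₀ y) := hh.isEmbedding.injective hwy
      have hΦe : Φ (e₀ y) ∈ Φ '' (𝓡∂ 3).boundary H := by rw [hΦbd, ← hw']; exact hw
      obtain ⟨w', hw'bd, hw'e⟩ := hΦe
      have he₀bd : e₀ y ∈ (𝓡∂ 3).boundary H := by rw [← Φ.injective hw'e]; exact hw'bd
      have hdyF : d y ∈ centralSurfaceSet T := by
        rw [hF, ← hde₀ y]; exact mem_image_of_mem h he₀bd
      have hdya : d y ∈ a := by rw [← hdF]; exact ⟨mem_range_self y, hdyF⟩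
      rw [← hra] at hdya
      obtain ⟨x, hx⟩ := hdya
      show d' y ∈ b
      rw [hstep y x hx.symm, ← hrb]
      exact mem_range_self x
    · intro z hz
      refine ⟨?_, hbF hz⟩
      rw [← hbd'] at hz
      obtain ⟨y, -, rfl⟩ := hz
      exact mem_range_self y

end Summit.SmoothPoincare4.SmoothPoincare4.Theorems

end
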